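import Summits.ABC.ABC.Theses.IsogenyGlueCongruence
import Summits.ABC.ABC.Theses.RibetTakahashiSplit
import Summits.ABC.ABC.Theorems.IsogenyGlueCongruenceMazurKenkuBoundOfRadius
import Summits.ABC.ABC.Theorems.IsogenyGlueCongruenceMazurKenkuBoundStubRadius
import Summits.ABC.ABC.Theorems.IsogenyGlueCongruenceMazurKenkuBoundStubCertEleven
import Summits.ABC.ABC.Theorems.IsogenyGlueCongruenceMazurKenkuBoundStubCertMid
import Summits.ABC.ABC.Theorems.IsogenyGlueCongruenceMazurKenkuBoundStubCertCM
import Summits.ABC.ABC.Theorems.IsogenyGlueCongruenceMazurKenkuBoundStubEightyone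
import Summits.ABC.ABC.Theorems.IsogenyGlueCongruenceMazurKenkuBoundStubTwoChainAlgebra
import Summits.ABC.ABC.Theorems.IsogenyGlueCongruenceMazurKenkuBoundStubTwoVertex
import Summits.ABC.ABC.Theorems.IsogenyGlueCongruenceMazurKenkuBoundStubTwoNormalize
import Summits.ABC.ABC.Theorems.IsogenyGlueCongruenceMazurKenkuBoundStubTwoStep
import Summits.ABC.ABC.Theorems.IsogenyGlueCongruenceMazurKenkuBoundStubCertThirteenComposite
import Summits.ABC.ABC.Theorems.IsogenyGlueCongruenceMazurKenkuBoundStubCertPrimePower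
import Summits.ABC.ABC.Theorems.IsogenyGlueCongruenceMazurKenkuBoundLevelThirtyTwo
import Summits.ABC.ABC.Theorems.IsogenyGlueCongruenceMazurKenkuBoundLevelTwenty
import Literature.NumberTheory.EllipticCurves.KenkuMinimalLevelsKleinFrickeFiveSeven
import Literature.NumberTheory.EllipticCurves.XZeroFifteenExplicit
import Literature.NumberTheory.EllipticCurves.XZeroTwentyOneExplicit
import Literature.NumberTheory.EllipticCurves.KleinFrickeLevelSevenJZero
import Summits.ABC.ABC.Theorems.IsogenyGlueCongruenceMazurKenkuBoundStubFifteenPoints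
import Literature.NumberTheory.EllipticCurves.Curve15A1Descent
import Literature.NumberTheory.EllipticCurves.Curve21A1Descent
import Summits.ABC.ABC.Theorems.IsogenyGlueCongruenceMazurKenkuBoundStubTwentyonePoints
import Literature.NumberTheory.EllipticCurves.OpenImageMazurInputsProofs
import Literature.NumberTheory.EllipticCurves.KleinFrickeLevelTwentySeven
import Literature.NumberTheory.EllipticCurves.PrimeDegreeIsogenyJTable
import HarnessLib

/-!
# Route `IsogenyGlueCongruence`, crux `MazurKenkuBound` (stmt-ABC-15125) — lead c22, skeleton of
# the merged line `radius-lite` ⊕ `Sketch`, reshape #3 (cycle 24, 2026-08-17)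

The crux is `mazurKenkuBound_of_radiusItem` (landed, p135527; Edixhoven input = theorem
`edixhovenIntegrality_proof`, p135258) applied to the Mazur–Kenku RADIUS (two `ℚ`-isogenous
elliptic curves over `ℚ` are joined by a `ℚ`-isogeny of degree `≤ 163`), and the radius is the
landed set-cover reduction `stub_radius_of_mazur_of_barrier` (p97843) over the radius-minimal
barrier set `liteBarrier` (75 levels, coverage kernel-certified below), fed by Mazur's Thm. 1
(`stub_cor44` + the PROVED Prop. 5.1) and the exclusion of every barrier level (`hexcl_of_stubs`).

State inherited from lead c21 (cycle 23, `Lines/radius_lite.lean` @419a5b2a): three PRINTED stubs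
`stub_cor44` (Mazur 1978 Cor. 4.4, XL), `stub_jTables` (ten `j`-tables), `stub_liteLevels6` (six
smooth levels); landed: certificates (p137957 p138082 p138194 p138666 p141688 p142758), level `32`
(p142392) and level `20` (p143941, p144351), both modular-curve-free.

## Cycle 24 (lead c22): the genus-one COMPOSITE table levels `15 = 3·5` and `21 = 3·7` are PROVED

`stub_jTables` is now a THEOREM, assembled from the printed stub `stub_jTables8` (the eight levels
`11, 17, 19, 27, 37, 43, 67, 163`) and the two composite genus-one levels, proved modular-curve-free
from Klein–Fricke at `3, 5, 7` through the fibre products `X₀(3) ×_{X(1)} X₀(5) ≅ 15a1` and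
`X₀(3) ×_{X(1)} X₀(7) ≅ 21a1` and the Mordell–Weil groups of `15a1` and `21a1`:

* level `15` (`levelFifteen_jTable`): the tree's explicit isomorphism `XZeroFifteen.exists_point`
  (Thorne 2019 Lemma 3) + LANDED `Curve15A1.finite_point` (p164644, complete `2`-descent,
  `Literature/…/Curve15A1Descent.lean`) + LANDED `stub_fifteenPoints` (p164365, reduction mod `7, 11`):
  `j ∈ {−25/2, 46969655/32768, −349938025/8, −121945/32}`;
* level `21` (`levelTwentyOne_jTable`): LANDED explicit isomorphism `XZeroTwentyOne.exists_point_rat`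
  (p164263, `Literature/…/XZeroTwentyOneExplicit.lean`: `x = P_X/d_X`, `y = P_Y/(t d_X)`,
  `t · B(x,y) = N(x,y)`, found from `q`-expansions and certified by polynomial identities) + LANDED
  `Isogeny.j_ne_zero_of_degree_eq_seven_rat` (p164792, `Literature/…/KleinFrickeLevelSevenJZero.lean`:
  no rational `7`-isogeny at `j = 0`, the fibre excluded by the tree's Klein–Fricke-`7` theorem) +
  LANDED `Curve21A1.finite_point` (p164609, `Literature/…/Curve21A1Descent.lean`) + LANDED
  `stub_twentyonePoints` (p163916, reduction mod `5, 11`):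
  `j ∈ {−1159088625/2097152, 3375/2, −189613868625/128, −140625/8}`.

Stubs (3, all PRINTED, no tree counterpart): `stub_cor44` (XL), `stub_jTables8`, `stub_liteLevels6`.
Reshape #3 (same cycle): Klein–Fricke at `7` is axiom-clean since the lead's kernel re-check of its
certificates (`Literature/…/KleinFrickeSevenCertificateKernel.lean`, p168900: Kronecker evaluation +
balanced-digit injectivity; proof-only patch of `klein_seven_core`, p169045), so level `21` uses the
tree theorem directly and the displayed stub `stub_kleinSevenRat` of reshape #2 is gone.
Composition (`MazurKenkuBound_of`, kernel-checked modulo the stubs) unchanged below `stub_jTables`.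
-/

-- `Summit.<Summit>.<Problem>` is the mandated summit-side namespace (CONVENTIONS §2); for the
-- single-conjunct summit `ABC` the two coincide, so the duplicate `ABC.ABC` is deliberate.
set_option linter.dupNamespace false

noncomputable section

open scoped Classical

open WeierstrassCurve
open Literature.NumberTheory.EllipticCurves

namespace Summit.ABC.ABC.Theorems

/-! ### Stub 1: Mazur 1978, Cor. 4.4 (the Eisenstein quotient) — XL named fact -/

/-- STUB (XL printed theorem; verbatim the named fact `Mazur1978.cor44_valuation_j_le_one` of
`OpenImageMazurInputs.lean`): an elliptic curve over `ℚ` with a rational `N`-isogeny, `N = 11` or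
`N ≥ 17` prime, has potentially good reduction at every odd prime (finiteness of `J̃(ℚ)` for the
Eisenstein quotient `J̃` of `J₀(N)` and the formal immersion at `∞`).
[cite: Mazur1978, Cor. 4.4 (p. 145), with Cor. 4.3 and Prop. 3.1] -/
theorem stub_cor44 : Mazur1978.cor44_valuation_j_le_one := by
  sorry

/-! ### Stub 2: the seven PRIME `j`-table levels (printed determinations of `X₀(ℓ)(ℚ)`) — named fact -/

/-- STUB (printed theorem; verbatim the named fact `primeDegreeIsogeny_jTable` of
`PrimeDegreeIsogenyJTable.lean`, p167545): a rational isogeny of prime degree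
`ℓ ∈ {11, 17, 19, 37, 43, 67, 163}` out of `V` has `(ℓ, j(V))` among the eleven tabulated pairs
(`X₀(11), X₀(17), X₀(19)` — Ligozat 1975; `X₀(37)` — Mazur–Swinnerton-Dyer 1974; `X₀(43), X₀(67),
X₀(163)` — Mazur 1978 table p. 129). After reshape #4 (lead c23) this and `stub_cor44` are the only
inputs of the tables half that are not tree theorems: the composite levels `15, 21` (lead c22) and
`27` (`Isogeny.j_eq_of_isCyclic_degree_twentySeven`, p171877) are PROVED.
[cite: CremonaAlgorithms1997, §3.8 p. 82] [cite: Mazur1978, Thm. 1 and table p. 129] [cite: Ligozat1975] -/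
theorem stub_jTables7 : primeDegreeIsogeny_jTable := by
  sorry

/-- The eleven prime-level rows are rows of `kenkuIsogenyJTable` (finite check). [cite: Kenku1982, proof of Thm. 1, p. 200] -/
theorem largePrimeIsogenyJTable_sub_kenku :
    ∀ r ∈ largePrimeIsogenyJTable, r ∈ kenkuIsogenyJTable := by
  decide +kernel

/-- **Level `27` of Kenku's table is a tree theorem** (p171877, `KleinFrickeLevelTwentySeven`:
Klein–Fricke at `9` twice on the `3`-quotient + Euler's case `n = 3` of Fermat): a rational cyclic
`27`-isogeny forces `j = -2¹⁵·3·5³`, i.e. `(27, j) ∈ kenkuIsogenyJTable`. [cite: Kenku1982, proof of Thm. 1, p. 200] -/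
theorem levelTwentySeven_jTable (V V' : WeierstrassCurve ℚ) [V.IsElliptic] [V'.IsElliptic]
    (ψ : Isogeny V V') (hψ : ψ.IsCyclic) (h27 : ψ.degree = 27) :
    (ψ.degree, V.j) ∈ kenkuIsogenyJTable := by
  rw [h27, ψ.j_eq_of_isCyclic_degree_twentySeven hψ h27]
  decide +kernel

/-- The eight non-`15, 21` table levels from the prime named fact and the level-`27` theorem.
[cite: Kenku1982, proof of Thm. 1, p. 200] -/
theorem jTables8_of_stub :
    ∀ (V V' : WeierstrassCurve ℚ) [V.IsElliptic] [V'.IsElliptic] (ψ : Isogeny V V'),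
      ψ.IsCyclic → ψ.degree ∈ ({11, 17, 19, 27, 37, 43, 67, 163} : Finset ℕ) →
        (ψ.degree, V.j) ∈ kenkuIsogenyJTable := by
  intro V V' _ _ ψ hψ hmem
  have hsplit : ∀ n ∈ ({11, 17, 19, 27, 37, 43, 67, 163} : Finset ℕ),
      n = 27 ∨ n ∈ ({11, 17, 19, 37, 43, 67, 163} : Finset ℕ) := by decide
  rcases hsplit _ hmem with h27 | h7
  · exact levelTwentySeven_jTable V V' ψ hψ h27
  · exact largePrimeIsogenyJTable_sub_kenku _ (stub_jTables7 V V' ψ h7)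

/-! ### The Mordell–Weil groups of `15a1 ≅ X₀(15)` and `21a1 ≅ X₀(21)` — ALL FOUR STUBS LANDED (wave 1)
`stub_fifteenFinite` = `Literature.NumberTheory.EllipticCurves.Curve15A1.finite_point` (p164644,
`Literature/NumberTheory/EllipticCurves/Curve15A1Descent.lean`, complete `2`-descent);
`stub_fifteenPoints` (p164365, `Theorems/…StubFifteenPoints.lean`, reduction mod `7, 11`);
`stub_twentyoneFinite` = `Literature.NumberTheory.EllipticCurves.Curve21A1.finite_point` (p164609,
`Literature/NumberTheory/EllipticCurves/Curve21A1Descent.lean`); `stub_twentyonePoints` (p163916,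
`Theorems/…StubTwentyonePoints.lean`, reduction mod `5, 11`). The two finiteness stubs are used below
under their Literature names (a Theorems restatement is refused by the gate as `dedup.landed`). -/

/-! ### Level `15` PROVED: the fibre product `X₀(3) ×_{X(1)} X₀(5) ≅ 15a1` -/

/-- `20` is not a rational square. [folklore] -/
theorem rat_sq_ne_twenty (q : ℚ) : q ^ 2 ≠ 20 := fun h ↦
  rat_sq_ne_five (q / 2) (by rw [div_pow, h]; norm_num)

/-- On `X₀(5)`, a RATIONAL Klein–Fricke parameter never lies over `j = 0` or `j = 1728`:
`j H = (H² + 10H + 5)³`, `H ∈ ℚ` forces `j ≠ 0` (`(H + 5)² = 20`) and `j ≠ 1728`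
(`(H² + 10H + 5)³ − 1728 H = (H² + 4H − 1)²(H² + 22H + 125)`, `(H + 2)² = 5`,
`(H + 11)² + 4 = 0`). [folklore] -/
theorem klein_five_j_ne_zero_and_ne_1728 {j H : ℚ}
    (hjH : j * H = (H ^ 2 + 10 * H + 5) ^ 3) : j ≠ 0 ∧ j ≠ 1728 := by
  constructor
  · rintro rfl
    have h3 : (H ^ 2 + 10 * H + 5) ^ 3 = 0 := by rw [← hjH]; ring
    have h1 : H ^ 2 + 10 * H + 5 = 0 := pow_eq_zero_iff (by norm_num) |>.mp h3
    exact rat_sq_ne_twenty (H + 5) (by linear_combination h1)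
  · rintro rfl
    have hfac : (H ^ 2 + 4 * H - 1) ^ 2 * (H ^ 2 + 22 * H + 125) = 0 := by
      linear_combination -hjH
    rcases mul_eq_zero.mp hfac with h | h
    · have h1 : H ^ 2 + 4 * H - 1 = 0 := pow_eq_zero_iff (by norm_num) |>.mp h
      exact rat_sq_ne_five (H + 2) (by linear_combination h1)
    · nlinarith [sq_nonneg (H + 11)]

/-- **Level `15` (Kenku's table at `N = 15`; `X₀(15)(ℚ)`, Ligozat / Antwerp IV)**: a cyclic `ℚ`-isogeny of degree `15` out of `V` has
`j(V) ∈ {−5²/2, −5²·241³/2³, −5·29³/2⁵, 5·211³/2¹⁵}`, i.e. `(15, j(V)) ∈ kenkuIsogenyJTable`.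
Proof: Klein–Fricke at `3` and `5` (`exists_j_eq_klein_three/five_of_…_dvd_degree`) give a
non-cuspidal rational point of the fibre product `X₀(3) ×_{X(1)} X₀(5)`, which the tree's explicit
isomorphism `XZeroFifteen.exists_point` sends to a rational point `(x, y)` of `15a1` carrying
`j(V)` as the value of the rational function `(N² + 10NB + 5B²)³/(N B⁵)`; the eight rational points
of `15a1` (landed: `Curve15A1.finite_point`, `stub_fifteenPoints`) are the four cusps (`N B⁵ = 0`, excluded) and four points with exactly the
tabulated values. [cite: Kenku1982, proof of Thm. 1, p. 200] [cite: Ligozat1975]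
[cite: Thorne2019, proof of Lemma 3] -/
theorem levelFifteen_jTable (V V' : WeierstrassCurve ℚ) [V.IsElliptic] [V'.IsElliptic]
    (ψ : Isogeny V V') (hψ : ψ.IsCyclic) (hdeg : ψ.degree = 15) :
    (15, V.j) ∈ kenkuIsogenyJTable := by
  obtain ⟨F, hF0, hjF⟩ :=
    ψ.exists_j_eq_klein_three_of_three_dvd_degree hψ (hdeg ▸ (by norm_num : (3 : ℕ) ∣ 15))
  obtain ⟨H, hH0, hjH⟩ :=
    ψ.exists_j_eq_klein_five_of_five_dvd_degree hψ (hdeg ▸ (by norm_num : (5 : ℕ) ∣ 15))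
  have hjF' : V.j * F = (F + 27) * (F + 3) ^ 3 := by
    rw [hjF]; field_simp
  have hjH' : V.j * H = (H ^ 2 + 10 * H + 5) ^ 3 := by
    rw [hjH]; field_simp
  obtain ⟨hj0, hj1728⟩ := klein_five_j_ne_zero_and_ne_1728 hjH'
  rcases XZeroFifteen.exists_point hH0 hjF' hjH' with h0 | h1728 | ⟨x, y, hxy, hNB, hj⟩
  · exact absurd h0 hj0
  · exact absurd h1728 hj1728
  have hmem := stub_fifteenPoints Curve15A1.finite_point x y hxy
  simp only [Finset.mem_insert, Finset.mem_singleton, Prod.mk.injEq] at hmem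
  rcases hmem with ⟨rfl, rfl⟩ | ⟨rfl, rfl⟩ | ⟨rfl, rfl⟩ | ⟨rfl, rfl⟩ | ⟨rfl, rfl⟩ | ⟨rfl, rfl⟩ |
    ⟨rfl, rfl⟩
  · norm_num at hj
    rw [show V.j = -25 / 2 by linarith [hj]]
    decide +kernel
  · norm_num at hNB
  · norm_num at hj
    rw [show V.j = 46969655 / 32768 by linarith [hj]]
    decide +kernel
  · norm_num at hNB
  · norm_num at hj
    rw [show V.j = -349938025 / 8 by linarith [hj]]
    decide +kernel
  · norm_num at hNB
  · norm_num at hj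
    rw [show V.j = -121945 / 32 by linarith [hj]]
    decide +kernel

/-! ### Klein–Fricke at `7` over `ℚ` — a tree THEOREM, axiom-clean since the kernel re-check of its
certificates (`KleinFrickeSevenCertificateKernel`, p168900; proof-only patch of `klein_seven_core`,
p169045): `Isogeny.exists_j_eq_klein_seven_of_degree_eq_seven` + `Isogeny.j_ne_zero_of_degree_eq_seven_rat`
(`KleinFrickeLevelSevenJZero`, p164792); the former stub `stub_kleinSevenRat` (landed p165837) is no
longer displayed. -/

/-! ### Level `21` PROVED: the fibre product `X₀(3) ×_{X(1)} X₀(7) ≅ 21a1` -/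

/-- **Level `21` (Kenku's table at `N = 21`; `X₀(21)(ℚ)`, Ligozat / Antwerp IV)**: a cyclic `ℚ`-isogeny of degree `21` out of `V` has
`j(V) ∈ {−3²5⁶/2³, 3³5³/2, −3²5³101³/2²¹, −3³5³383³/2⁷}`, i.e. `(21, j(V)) ∈ kenkuIsogenyJTable`.
Proof: Klein–Fricke at `3` and at `7` (tree theorems; at `7` applied to the cyclic degree-`7`
quotient, with `j ≠ 0` by `Isogeny.j_ne_zero_of_degree_eq_seven_rat`) give a non-cuspidal rational point `(F, t)` of `X₀(3) ×_{X(1)} X₀(7)`, which the landed explicit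
isomorphism `XZeroTwentyOne.exists_point_rat` (p164263) sends to a rational point `(x, y)` of
`21a1` with `t · B(x, y) = N(x, y)`; of the eight rational points of `21a1` (landed
`stub_twentyonePoints`, p163916, fed by the landed `Curve21A1.finite_point`, p164609) the four cusps give `B = 0 ≠ N` or
`t = 0`, and the other four give `t ∈ {−49/8, −2, −49/2, −8}`, whose Klein–Fricke values are the
four tabulated `j`. [cite: Kenku1982, proof of Thm. 1, p. 200] [cite: Ligozat1975] -/
theorem levelTwentyOne_jTable (V V' : WeierstrassCurve ℚ) [V.IsElliptic] [V'.IsElliptic]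
    (ψ : Isogeny V V') (hψ : ψ.IsCyclic) (hdeg : ψ.degree = 21) :
    (21, V.j) ∈ kenkuIsogenyJTable := by
  obtain ⟨F, hF0, hjF⟩ :=
    ψ.exists_j_eq_klein_three_of_three_dvd_degree hψ (hdeg ▸ (by norm_num : (3 : ℕ) ∣ 21))
  obtain ⟨t, ht0, hjt⟩ : ∃ t : ℚ, t ≠ 0 ∧
      V.j = (t ^ 2 + 13 * t + 49) * (t ^ 2 + 5 * t + 1) ^ 3 / t := by
    obtain ⟨V₇, hV₇, χ, -, hχd, -⟩ :=
      ψ.exists_isCyclic_degree_eq_of_dvd hψ (d := 7) (hdeg ▸ (by norm_num : (7 : ℕ) ∣ 21))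
    haveI := hV₇
    exact χ.exists_j_eq_klein_seven_of_degree_eq_seven hχd (χ.j_ne_zero_of_degree_eq_seven_rat hχd)
  have hjF' : V.j * F = (F + 27) * (F + 3) ^ 3 := by
    rw [hjF]; field_simp
  have hjt' : V.j * t = (t ^ 2 + 13 * t + 49) * (t ^ 2 + 5 * t + 1) ^ 3 := by
    rw [hjt]; field_simp
  obtain ⟨x, y, hxy, hNB⟩ := XZeroTwentyOne.exists_point_rat ht0 hjF' hjt'
  have hmem := stub_twentyonePoints Curve21A1.finite_point x y hxy
  simp only [Finset.mem_insert, Finset.mem_singleton, Prod.mk.injEq] at hmem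
  rcases hmem with ⟨rfl, rfl⟩ | ⟨rfl, rfl⟩ | ⟨rfl, rfl⟩ | ⟨rfl, rfl⟩ | ⟨rfl, rfl⟩ | ⟨rfl, rfl⟩ |
    ⟨rfl, rfl⟩
  · norm_num at hNB
  · norm_num at hNB
    rw [show t = -49 / 8 by linarith [hNB]] at hjt
    norm_num at hjt
    rw [hjt]
    decide +kernel
  · norm_num at hNB
    exact absurd hNB ht0
  · norm_num at hNB
    rw [show t = -2 by linarith [hNB]] at hjt
    norm_num at hjt
    rw [hjt]
    decide +kernel
  · norm_num at hNB
    rw [show t = -49 / 2 by linarith [hNB]] at hjt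
    norm_num at hjt
    rw [hjt]
    decide +kernel
  · norm_num at hNB
  · norm_num at hNB
    rw [show t = -8 by linarith [hNB]] at hjt
    norm_num at hjt
    rw [hjt]
    decide +kernel

/-- **The ten `j`-tables** (`radius-lite`'s `stub_jTables`, now a THEOREM): the eight printed ones
(`stub_jTables8`) and the proved composite genus-one levels `15` (`levelFifteen_jTable`) and `21`
(`levelTwentyOne_jTable`). [cite: Kenku1982, proof of Thm. 1, p. 200] -/
theorem stub_jTables :
    ∀ (V V' : WeierstrassCurve ℚ) [V.IsElliptic] [V'.IsElliptic] (ψ : Isogeny V V'),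
      ψ.IsCyclic → ψ.degree ∈ ({11, 15, 17, 19, 21, 27, 37, 43, 67, 163} : Finset ℕ) →
        (ψ.degree, V.j) ∈ kenkuIsogenyJTable := by
  intro V V' _ _ ψ hψ hmem
  have hsplit : ∀ n ∈ ({11, 15, 17, 19, 21, 27, 37, 43, 67, 163} : Finset ℕ),
      n = 15 ∨ n = 21 ∨ n ∈ ({11, 17, 19, 27, 37, 43, 67, 163} : Finset ℕ) := by decide
  rcases hsplit _ hmem with h15 | h21 | h8
  · rw [h15]; exact levelFifteen_jTable V V' ψ hψ h15
  · rw [h21]; exact levelTwentyOne_jTable V V' ψ hψ h21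
  · exact jTables8_of_stub V V' ψ hψ h8

/-! ### Level `49 = 7·7` (lead c23, reshape #4): `X₀(49) ≅ X_sp(7)` on the ABSTRACT middle curve

A cyclic rational `49`-isogeny `ψ : V → V'` with kernel `ℤP` gives, on the quotient
`V₁ = V/⟨7P⟩` (the tree's PROVED `exists_isogeny_ker_eq_and_comp_eq_nsmul_holds`), two DISTINCT
`Γ_ℚ`-stable cyclic subgroups of order `7` (`stub_middleSeven`); the Tate normal form at a point of
order `7` (Kubert's `E(b, c)`, `b = d³ - d²`, `c = d² - d`) makes each of them an `F`-rational value
`η = (d³ - 8d² + 5d + 1)/(d(d - 1))` of the Hauptmodul of `X₀(7)` with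
`j · η = (η² + 13η + 49)(η² + 5η + 1)³` (`stub_hauptmodulSeven`, the level-`7` sibling of the tree's
`exists_hauptmodul_nine_of_torsion`, WITH the value); distinct subgroups give distinct values
(`stub_kubertSevenRigidity`: equal values put the two Tate parameters in one orbit of the deck
transformation `d ↦ 1/(1 - d)` of `X₁(7) → X₀(7)`, and a Weierstrass equation with `c₄c₆ ≠ 0` has
no automorphism with `r ≠ 0`); two distinct nonzero rational `s, t` with `P(s)/s = P(t)/t` are a
non-cuspidal rational point of `X₀(49) ≅ 49a1`, which has none (`stub_level49Endgame`:
explicit map to `49a1 : y² + xy = x³ - x² - 2x - 1` and `49a1(ℚ) = {O, (2, -1)}` by `2`-isogeny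
descent). [cite: Kenku1982, proof of Thm. 1, p. 200] [cite: Ligozat1975] -/

/-- STUB A (middle curve, M): a cyclic rational `49`-isogeny out of `V` yields an elliptic curve
`V₁/ℚ` (the quotient of `V` by the order-`7` subgroup of the kernel) carrying two points
`P₁, P₂ ∈ V₁(ℚ̄)` of order `7` whose cyclic subgroups are `Γ_ℚ`-stable and distinct (the image of the
kernel and the image of `V[7]`). [cite: SilvermanAEC2009, Prop. III.4.12 and Rem. III.4.13.2] -/
theorem stub_middleSeven :
    ∀ (V V' : WeierstrassCurve ℚ) [V.IsElliptic] [V'.IsElliptic] (ψ : Isogeny V V'),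
      ψ.IsCyclic → ψ.degree = 49 →
      ∃ (V₁ : WeierstrassCurve ℚ) (_ : V₁.IsElliptic) (P₁ P₂ : V₁.geomPoints),
        addOrderOf P₁ = 7 ∧ addOrderOf P₂ = 7 ∧
        (∀ σ : Field.absoluteGaloisGroup ℚ, σ • P₁ ∈ AddSubgroup.zmultiples P₁) ∧
        (∀ σ : Field.absoluteGaloisGroup ℚ, σ • P₂ ∈ AddSubgroup.zmultiples P₂) ∧
        P₂ ∉ AddSubgroup.zmultiples P₁ := by
  sorry

/-- STUB B (Klein–Fricke at `7` from a torsion point, with the VALUE of the Hauptmodul; L): for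
`W/F` elliptic, `L/F` Galois and `P = (x, y) ∈ W(L)` of order `7` with `Gal(L/F)`-stable `ℤP`, the
tangent-normalised coefficients `A₁, A₂, A₃` of `W_L` at `P` (`WeierstrassCurve.tgA₁/₂/₃`) are
Kubert's `u(1 - d(d-1)), -u²d²(d-1), -u³d²(d-1)` for the Tate parameter `d = -A₂³/(A₃(A₃ - A₁A₂))`,
`u = A₃/A₂` (`d(d - 1) ≠ 0`), and `η := (d³ - 8d² + 5d + 1)/(d(d-1))` lies in `F` and satisfies
`j(W) · η = (η² + 13η + 49)(η² + 5η + 1)³` (Maier, Table 4, level `7`; Kubert 1976 Table 3).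
[cite: Maier2006, Table 4 (N = 7)] [cite: Kubert1976, Table 3] -/
theorem stub_hauptmodulSeven :
    ∀ {F : Type} [Field F] {L : Type} [Field L] [Algebra F L] [IsGalois F L]
      (W : WeierstrassCurve F) [W.IsElliptic] {x y : L}
      {h : (W.baseChange L).toAffine.Nonsingular x y},
      addOrderOf (Affine.Point.some x y h : (W.baseChange L).toAffine.Point) = 7 →
      (∀ σ : L ≃ₐ[F] L, σ • (Affine.Point.some x y h : (W.baseChange L).toAffine.Point) ∈
          AddSubgroup.zmultiples (Affine.Point.some x y h : (W.baseChange L).toAffine.Point)) →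
      (W.baseChange L).tgA₂ x y ≠ 0 ∧ (W.baseChange L).tgA₃ x y ≠ 0 ∧
      (W.baseChange L).tgA₃ x y - (W.baseChange L).tgA₁ x y * (W.baseChange L).tgA₂ x y ≠ 0 ∧
      ∀ d u : L,
        d = -(W.baseChange L).tgA₂ x y ^ 3 /
              ((W.baseChange L).tgA₃ x y *
                ((W.baseChange L).tgA₃ x y - (W.baseChange L).tgA₁ x y * (W.baseChange L).tgA₂ x y)) →
        u = (W.baseChange L).tgA₃ x y / (W.baseChange L).tgA₂ x y →
        d ≠ 0 ∧ d - 1 ≠ 0 ∧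
        (W.baseChange L).tgA₁ x y = u * (1 - d * (d - 1)) ∧
        (W.baseChange L).tgA₂ x y = -(u ^ 2 * (d ^ 2 * (d - 1))) ∧
        (W.baseChange L).tgA₃ x y = -(u ^ 3 * (d ^ 2 * (d - 1))) ∧
        ∃ η : F, W.j * η = (η ^ 2 + 13 * η + 49) * (η ^ 2 + 5 * η + 1) ^ 3 ∧
          algebraMap F L η * (d * (d - 1)) = d ^ 3 - 8 * d ^ 2 + 5 * d + 1 := by
  sorry

/-- STUB C (rigidity of Kubert's level-`7` normal forms, M): if two `u = 1` changes of variables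
put the same Weierstrass equation `E` (`c₄c₆ ≠ 0`, characteristic `0`) into Kubert forms
`[u(1 - d(d-1)), -u²d²(d-1), -u³d²(d-1), 0, 0]` and `[u'(…d'…), …]` whose Tate parameters have the
same Hauptmodul value (`(d³-8d²+5d+1)·d'(d'-1) = (d'³-8d'²+5d'+1)·d(d-1)`), then the two
translations differ by `0`, `x(2P₀) = u²d²(d-1)` or `x(3P₀) = u²d(d-1)`: `d' ∈ {d, 1/(1-d), (d-1)/d}`
(the deck orbit), the deck transformation is realised by re-normalising at `2P₀`/`3P₀`, and a
self-equivalence of an equation with `c₄c₆ ≠ 0` has `u² = 1`, `r = 0`. [cite: Kubert1976, Table 3]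
[cite: SilvermanAEC2009, III.1 Table 3.1 and III.10] -/
theorem stub_kubertSevenRigidity :
    ∀ {L : Type} [Field L] [CharZero L] (E : WeierstrassCurve L) (C C' : VariableChange L)
      (u d u' d' : L),
      C.u = 1 → C'.u = 1 →
      (C • E).a₁ = u * (1 - d * (d - 1)) → (C • E).a₂ = -(u ^ 2 * (d ^ 2 * (d - 1))) →
      (C • E).a₃ = -(u ^ 3 * (d ^ 2 * (d - 1))) → (C • E).a₄ = 0 → (C • E).a₆ = 0 →
      (C' • E).a₁ = u' * (1 - d' * (d' - 1)) → (C' • E).a₂ = -(u' ^ 2 * (d' ^ 2 * (d' - 1))) →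
      (C' • E).a₃ = -(u' ^ 3 * (d' ^ 2 * (d' - 1))) → (C' • E).a₄ = 0 → (C' • E).a₆ = 0 →
      u ≠ 0 → u' ≠ 0 → d * (d - 1) ≠ 0 → d' * (d' - 1) ≠ 0 →
      (d ^ 3 - 8 * d ^ 2 + 5 * d + 1) * (d' * (d' - 1)) =
        (d' ^ 3 - 8 * d' ^ 2 + 5 * d' + 1) * (d * (d - 1)) →
      E.c₄ ≠ 0 → E.c₆ ≠ 0 →
      C'.r = C.r ∨ C'.r = C.r + u ^ 2 * (d ^ 2 * (d - 1)) ∨ C'.r = C.r + u ^ 2 * (d * (d - 1)) := by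
  sorry

/-- STUB D (the Diophantine endgame, L): two DISTINCT nonzero rationals cannot have the same value
of the level-`7` modular function `R₇(h) = (h² + 13h + 49)(h² + 5h + 1)³/h` — the plane curve
`P(s)t = P(t)s, s ≠ t` is `X₀(49) ≅ X_sp(7)`, birational over `ℚ` to `49a1 : y² + xy = x³ - x² - 2x - 1`,
whose only rational points are the two cusps `O, (2, -1)` (`2`-isogeny descent over the bad prime
`7`; Ligozat 1975, Cremona Table 1 `49a1`). [cite: Ligozat1975] [cite: CremonaAlgorithms1997, Table 1 (49a1)] -/
theorem stub_level49Endgame :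
    ∀ s t : ℚ, s ≠ t → s ≠ 0 → t ≠ 0 →
      (s ^ 2 + 13 * s + 49) * (s ^ 2 + 5 * s + 1) ^ 3 * t =
        (t ^ 2 + 13 * t + 49) * (t ^ 2 + 5 * t + 1) ^ 3 * s → False := by
  sorry

/-- GLUE (lead c23, in progress — registered as a stub until its proof compiles): level `49` from
stubs A–D. [cite: Kenku1982, proof of Thm. 1, p. 200] -/
theorem stub_levelFortyNineGlue :
    (∀ (V V' : WeierstrassCurve ℚ) [V.IsElliptic] [V'.IsElliptic] (ψ : Isogeny V V'),
      ψ.IsCyclic → ψ.degree = 49 →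
      ∃ (V₁ : WeierstrassCurve ℚ) (_ : V₁.IsElliptic) (P₁ P₂ : V₁.geomPoints),
        addOrderOf P₁ = 7 ∧ addOrderOf P₂ = 7 ∧
        (∀ σ : Field.absoluteGaloisGroup ℚ, σ • P₁ ∈ AddSubgroup.zmultiples P₁) ∧
        (∀ σ : Field.absoluteGaloisGroup ℚ, σ • P₂ ∈ AddSubgroup.zmultiples P₂) ∧
        P₂ ∉ AddSubgroup.zmultiples P₁) →
    (∀ {F : Type} [Field F] {L : Type} [Field L] [Algebra F L] [IsGalois F L]
      (W : WeierstrassCurve F) [W.IsElliptic] {x y : L}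
      {h : (W.baseChange L).toAffine.Nonsingular x y},
      addOrderOf (Affine.Point.some x y h : (W.baseChange L).toAffine.Point) = 7 →
      (∀ σ : L ≃ₐ[F] L, σ • (Affine.Point.some x y h : (W.baseChange L).toAffine.Point) ∈
          AddSubgroup.zmultiples (Affine.Point.some x y h : (W.baseChange L).toAffine.Point)) →
      (W.baseChange L).tgA₂ x y ≠ 0 ∧ (W.baseChange L).tgA₃ x y ≠ 0 ∧
      (W.baseChange L).tgA₃ x y - (W.baseChange L).tgA₁ x y * (W.baseChange L).tgA₂ x y ≠ 0 ∧
      ∀ d u : L,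
        d = -(W.baseChange L).tgA₂ x y ^ 3 /
              ((W.baseChange L).tgA₃ x y *
                ((W.baseChange L).tgA₃ x y - (W.baseChange L).tgA₁ x y * (W.baseChange L).tgA₂ x y)) →
        u = (W.baseChange L).tgA₃ x y / (W.baseChange L).tgA₂ x y →
        d ≠ 0 ∧ d - 1 ≠ 0 ∧
        (W.baseChange L).tgA₁ x y = u * (1 - d * (d - 1)) ∧
        (W.baseChange L).tgA₂ x y = -(u ^ 2 * (d ^ 2 * (d - 1))) ∧
        (W.baseChange L).tgA₃ x y = -(u ^ 3 * (d ^ 2 * (d - 1))) ∧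
        ∃ η : F, W.j * η = (η ^ 2 + 13 * η + 49) * (η ^ 2 + 5 * η + 1) ^ 3 ∧
          algebraMap F L η * (d * (d - 1)) = d ^ 3 - 8 * d ^ 2 + 5 * d + 1) →
    (∀ {L : Type} [Field L] [CharZero L] (E : WeierstrassCurve L) (C C' : VariableChange L)
      (u d u' d' : L),
      C.u = 1 → C'.u = 1 →
      (C • E).a₁ = u * (1 - d * (d - 1)) → (C • E).a₂ = -(u ^ 2 * (d ^ 2 * (d - 1))) →
      (C • E).a₃ = -(u ^ 3 * (d ^ 2 * (d - 1))) → (C • E).a₄ = 0 → (C • E).a₆ = 0 →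
      (C' • E).a₁ = u' * (1 - d' * (d' - 1)) → (C' • E).a₂ = -(u' ^ 2 * (d' ^ 2 * (d' - 1))) →
      (C' • E).a₃ = -(u' ^ 3 * (d' ^ 2 * (d' - 1))) → (C' • E).a₄ = 0 → (C' • E).a₆ = 0 →
      u ≠ 0 → u' ≠ 0 → d * (d - 1) ≠ 0 → d' * (d' - 1) ≠ 0 →
      (d ^ 3 - 8 * d ^ 2 + 5 * d + 1) * (d' * (d' - 1)) =
        (d' ^ 3 - 8 * d' ^ 2 + 5 * d' + 1) * (d * (d - 1)) →
      E.c₄ ≠ 0 → E.c₆ ≠ 0 →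
      C'.r = C.r ∨ C'.r = C.r + u ^ 2 * (d ^ 2 * (d - 1)) ∨ C'.r = C.r + u ^ 2 * (d * (d - 1))) →
    (∀ s t : ℚ, s ≠ t → s ≠ 0 → t ≠ 0 →
      (s ^ 2 + 13 * s + 49) * (s ^ 2 + 5 * s + 1) ^ 3 * t =
        (t ^ 2 + 13 * t + 49) * (t ^ 2 + 5 * t + 1) ^ 3 * s → False) →
    ∀ (V V' : WeierstrassCurve ℚ) [V.IsElliptic] [V'.IsElliptic] (ψ : Isogeny V V'),
      ψ.IsCyclic → ψ.degree ≠ 49 := by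
  sorry

/-- **Level `49`** (no cyclic rational `49`-isogeny) from stubs A–D through the glue. This is
child `KenkuLevelFortyNine` (stmt-ABC-18226) of the crux split. [cite: Kenku1982, proof of Thm. 1, p. 200] -/
theorem levelFortyNine_of_stubs :
    ∀ (V V' : WeierstrassCurve ℚ) [V.IsElliptic] [V'.IsElliptic] (ψ : Isogeny V V'),
      ψ.IsCyclic → ψ.degree ≠ 49 :=
  stub_levelFortyNineGlue stub_middleSeven stub_hauptmodulSeven stub_kubertSevenRigidity
    stub_level49Endgame

/-! ### Stub 3: the five smooth levels `26, 35, 65, 125, 169` (printed `Y₀(N)(ℚ) = ∅`; radius-minimal) -/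

/-- STUB (printed determinations, each necessary for the radius): no cyclic `ℚ`-isogeny of an
elliptic curve over `ℚ` has degree `26, 35, 65, 125` or `169` (`X₀(26)`: genus two, Mazur–Vélu /
Ogg; `X₀(35)`: genus three, Kubert; `X₀(65)`, `X₀(169)`: Kenku 1980; `X₀(125)`: Kenku 1981 — as
assembled in Kenku 1982; = conjunct (ii) of child `KenkuPrintedLevels`, stmt-ABC-18224). The other
radius levels `20`, `32` (lead c21) and `49` (above) are handled modular-curve-free.
[cite: Kenku1982, proof of Thm. 1, pp. 200–201] -/
theorem stub_liteLevels5 :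
    ∀ (V V' : WeierstrassCurve ℚ) [V.IsElliptic] [V'.IsElliptic] (ψ : Isogeny V V'),
      ψ.IsCyclic → ψ.degree ∉ ({26, 35, 65, 125, 169} : Finset ℕ) := by
  sorry

/-- The six smooth levels of reshape #3 from the five printed ones and level `49`.
[cite: Kenku1982, proof of Thm. 1, pp. 200–201] -/
theorem liteLevels6_of_stubs :
    ∀ (V V' : WeierstrassCurve ℚ) [V.IsElliptic] [V'.IsElliptic] (ψ : Isogeny V V'),
      ψ.IsCyclic → ψ.degree ∉ ({26, 35, 49, 65, 125, 169} : Finset ℕ) := by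
  intro V V' _ _ ψ hψ hmem
  have hsplit : ∀ n ∈ ({26, 35, 49, 65, 125, 169} : Finset ℕ),
      n = 49 ∨ n ∈ ({26, 35, 65, 125, 169} : Finset ℕ) := by decide
  rcases hsplit _ hmem with h49 | h5
  · exact levelFortyNine_of_stubs V V' ψ hψ h49
  · exact stub_liteLevels5 V V' ψ hψ h5

/-! ### Level `20` — LANDED (p143941 Diophantine end, p144351 assembly): `stub_levelTwenty` /
`isogeny_isCyclic_degree_ne_twenty_holds`, `Theorems/IsogenyGlueCongruenceMazurKenkuBoundLevelTwenty.lean` —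
no cyclic `ℚ`-isogeny of degree `20`, modular-curve-free (Belyĭ inversion of `X₀(10)`, curve `20a1`,
`X1TwoTen_points`). -/



/-! ### Stub 4 `stub_certThirteenComposite` (no `13`-isogeny out of the five `j` of levels `21, 27`)
### — LANDED (p141688, wave 3), `Theorems/IsogenyGlueCongruenceMazurKenkuBoundStubCertThirteenComposite.lean` -/


/-! ### Stub 5 `stub_certPrimePower` (twenty prime-power certificates; replaces Kenku's uniqueness schema)
### — LANDED (p142758, lead), `Theorems/IsogenyGlueCongruenceMazurKenkuBoundStubCertPrimePower.lean`, over the Literature rows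
### `KenkuPrimeSquareLevelCertificates` (p141712), `KenkuNineTwentyfiveLevelCertificates` (p141958), criterion p141370 -/


/-! ### Level `32` — LANDED (p142392): `stub_levelThirtyTwo` / `isogeny_isCyclic_degree_ne_thirtyTwo`,
`Theorems/IsogenyGlueCongruenceMazurKenkuBoundLevelThirtyTwo.lean` — no cyclic `ℚ`-isogeny of degree `32`,
modular-curve-free, from the four landed two-chain stubs `stub_twoNormalize` (p141542),
`stub_twoVertex` (p141021), `stub_twoStep` (p141564), `stub_twoChainAlgebra` (p140195). -/

/-! ### Composition (kernel-checked; not stubs) -/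

/-- **The eight smooth radius levels** (`radius-lite`'s `stub_liteLevels`) from the six printed
ones and the modular-curve-free levels `20` and `32`. [cite: Kenku1982, proof of Thm. 1, pp. 200–201] -/
theorem liteLevels_of_stubs :
    ∀ (V V' : WeierstrassCurve ℚ) [V.IsElliptic] [V'.IsElliptic] (ψ : Isogeny V V'),
      ψ.IsCyclic → ψ.degree ∉ ({20, 26, 32, 35, 49, 65, 125, 169} : Finset ℕ) := by
  intro V V' _ _ ψ hψ hmem
  have hsplit : ∀ n ∈ ({20, 26, 32, 35, 49, 65, 125, 169} : Finset ℕ),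
      n = 20 ∨ n = 32 ∨ n ∈ ({26, 35, 49, 65, 125, 169} : Finset ℕ) := by decide
  rcases hsplit _ hmem with h20 | h32 | h6
  · exact stub_levelTwenty V V' ψ hψ h20
  · exact stub_levelThirtyTwo V V' ψ hψ h32
  · exact liteLevels6_of_stubs V V' ψ hψ h6

/-- The large-prime entries of `kenkuIsogenyJTable` have their `j` among the eleven tabulated
values, grouped as in stubs 4–6 (finite check). [cite: CremonaAlgorithms1997, §3.8 p. 82] -/
theorem kenkuIsogenyJTable_large :
    ∀ r ∈ kenkuIsogenyJTable, r.1 ∈ ({11, 17, 19, 37, 43, 67, 163} : Finset ℕ) →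
      r.2 ∈ ({-121, -24729001, -32768} : Finset ℚ) ∨
        r.2 ∈ ({-297756989 / 2, -882216989 / 131072, -884736, -9317, -162677523113838677} :
          Finset ℚ) ∨
        r.2 ∈ ({-884736000, -147197952000, -262537412640768000} : Finset ℚ) := by
  decide +kernel

/-- The radius-minimal barrier set: 75 degrees of rational cyclic isogenies to exclude (strategist
computation `compute/cover2.py`; 8 direct levels, 9 + 7 + 7 Klein–Fricke levels `2N, 3N, 5N`,
5 + 8 certificate levels `7N, 13N`, 21 products of two distinct large primes, 7 squares `p²`,
and `63, 75, 81`). [cite: Kenku1982, proof of Thm. 1, pp. 200–201] -/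
def liteBarrier : Finset ℕ :=
  {20, 22, 26, 32, 33, 34, 35, 38, 42, 49, 51, 54, 55, 57, 63, 65, 74, 75, 77, 81, 85, 86, 95, 111,
    121, 125, 129, 134, 169, 185, 187, 201, 209, 215, 221, 247, 259, 273, 289, 301, 323, 326, 335,
    351, 361, 407, 469, 473, 481, 489, 559, 629, 703, 731, 737, 815, 817, 871, 1139, 1141, 1273,
    1369, 1591, 1793, 1849, 2119, 2479, 2771, 2881, 3097, 4489, 6031, 7009, 10921, 26569}

/-- Coverage, core finite check: every `d ∈ (163, 163²]` dividing
`M = (∏ p ∈ mazurPrimes, p) ^ 15` has a divisor in `liteBarrier` (the technique of the landed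
`stub_barrierCovers`). [folklore] -/
theorem liteBarrier_covers_core :
    ∀ d ∈ Finset.Ioc 163 (163 * 163),
      2513949904356569433223257967352640030933105315529926545595966519862330822363561264580401831500102613762677080278731811953793950389512712599654334607051575147044201028738069671483180315700171693802399000000000000000
        % d = 0 → ∃ b ∈ liteBarrier, b ∣ d := by
  decide +kernel

/-- For every Mazur prime `p`, `p ^ 15` divides the modulus `M` of `liteBarrier_covers_core`.
[folklore] -/
theorem pow_fifteen_dvd_of_mem_mazurPrimes' :
    ∀ p ∈ mazurPrimes, p ^ 15 ∣
      2513949904356569433223257967352640030933105315529926545595966519862330822363561264580401831500102613762677080278731811953793950389512712599654334607051575147044201028738069671483180315700171693802399000000000000000 := by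
  decide +kernel

/-- **Coverage of the radius-minimal barrier set**: every `d ∈ (163, 163²]` all of whose prime
factors are Mazur primes has a divisor in `liteBarrier` (hypothesis (i) of
`stub_radius_of_mazur_of_barrier`; proof verbatim that of the landed `stub_barrierCovers`).
[folklore] -/
theorem liteBarrier_covers :
    ∀ d ∈ Finset.Ioc 163 (163 * 163), (∀ p ∈ d.primeFactors, p ∈ mazurPrimes) →
      ∃ b ∈ liteBarrier, b ∣ d := by
  intro d hd hmazur
  refine liteBarrier_covers_core d hd (Nat.mod_eq_zero_of_dvd ?_)
  obtain ⟨hd163, hd26569⟩ := Finset.mem_Ioc.mp hd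
  refine (Nat.dvd_iff_prime_pow_dvd_dvd _ _).mpr fun p k hp hpk => ?_
  rcases Nat.eq_zero_or_pos k with rfl | hk
  · exact (pow_zero p).symm ▸ one_dvd _
  have hpd : p ∣ d := (dvd_pow_self p hk.ne').trans hpk
  have hp_mem : p ∈ mazurPrimes := hmazur p (Nat.mem_primeFactors.mpr ⟨hp, hpd, by omega⟩)
  have hk15 : k ≤ 15 := by
    have h1 : p ^ k ≤ d := Nat.le_of_dvd (by omega) hpk
    have h2 : 2 ^ k ≤ p ^ k := Nat.pow_le_pow_left hp.two_le k
    by_contra hk15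
    have h3 : 2 ^ 16 ≤ 2 ^ k := Nat.pow_le_pow_right (by norm_num) (by omega)
    norm_num at h3
    omega
  exact (pow_dvd_pow p hk15).trans (pow_fifteen_dvd_of_mem_mazurPrimes' p hp_mem)

/-- The 75 barrier levels split by closing mechanism (finite check): direct levels, `2N`, `3N`,
`5N`, `7N`, `13N`, two distinct large primes, `p²`, and the five levels `63, 75, 81, 273, 351`.
[cite: Kenku1982, proof of Thm. 1, pp. 200–201] -/
theorem liteBarrier_split :
    ∀ b ∈ liteBarrier,
      b ∈ ({20, 26, 32, 35, 49, 65, 125, 169} : Finset ℕ) ∨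
      (∃ N ∈ ({11, 17, 19, 21, 27, 37, 43, 67, 163} : Finset ℕ), b = 2 * N) ∨
      (∃ N ∈ ({11, 17, 19, 37, 43, 67, 163} : Finset ℕ), b = 3 * N) ∨
      (∃ N ∈ ({11, 17, 19, 37, 43, 67, 163} : Finset ℕ), b = 5 * N) ∨
      (∃ N ∈ ({11, 17, 19, 37, 43, 67, 163} : Finset ℕ), b = 7 * N) ∨
      (∃ N ∈ ({11, 17, 19, 37, 43, 67, 163} : Finset ℕ), b = 13 * N) ∨
      (∃ q ∈ (({11, 17, 19, 37, 43, 67, 163} : Finset ℕ) ×ˢ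
          ({11, 17, 19, 37, 43, 67, 163} : Finset ℕ)), q.1 ≠ q.2 ∧ b = q.1 * q.2) ∨
      (∃ N ∈ ({11, 17, 19, 37, 43, 67, 163} : Finset ℕ), b = N * N) ∨
      (b = 63 ∨ b = 75 ∨ b = 81 ∨ b = 273 ∨ b = 351) := by
  decide +kernel

/-- The prime-level rows of `kenkuIsogenyJTable` lie in `largePrimeIsogenyJTable` (finite check).
[cite: CremonaAlgorithms1997, §3.8 p. 82] -/
theorem jTable_large_sub :
    ∀ r ∈ kenkuIsogenyJTable, r.1 ∈ ({11, 17, 19, 37, 43, 67, 163} : Finset ℕ) →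
      r ∈ largePrimeIsogenyJTable := by
  decide +kernel

/-- The rows of `kenkuIsogenyJTable` of level `21` or `27` have their `j` among the five values of
stub 5 (finite check). [cite: Kenku1982, proof of Thm. 1, p. 200] -/
theorem jTable_21_27_mem :
    ∀ r ∈ kenkuIsogenyJTable, (r.1 = 21 ∨ r.1 = 27) →
      r.2 ∈ ({-140625 / 8, 3375 / 2, -1159088625 / 2097152, -189613868625 / 128, -12288000} :
          Finset ℚ) := by
  decide +kernel

/-- The prime-power certificate table of stub 6 contains `(j, p²)` for every prime-level row
`(p, j)`, `(j, 9)` for the rows of level `21`, `(j, 25)` for the rows of level `15`, `(j, 81)`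
for the row of level `27` (finite check). [cite: Kenku1982, proof of Thm. 1, p. 200] -/
theorem jTable_primePower_mem :
    ∀ r ∈ kenkuIsogenyJTable,
      (r.1 ∈ ({11, 17, 19, 37, 43, 67, 163} : Finset ℕ) →
        (r.2, r.1 * r.1) ∈ ({((-32768 : ℚ), (121 : ℕ)), (-121, 121), (-24729001, 121),
          (-297756989 / 2, 289), (-882216989 / 131072, 289), (-884736, 361), (-9317, 1369),
          (-162677523113838677, 1369), (-884736000, 1849), (-147197952000, 4489),
          (-262537412640768000, 26569), (-140625 / 8, 9), (3375 / 2, 9),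
          (-1159088625 / 2097152, 9), (-189613868625 / 128, 9), (-25 / 2, 25),
          (-349938025 / 8, 25), (-121945 / 32, 25), (46969655 / 32768, 25), (-12288000, 81)} :
          Finset (ℚ × ℕ))) ∧
      (∀ m ∈ ({(21, 9), (15, 25), (27, 81)} : Finset (ℕ × ℕ)), r.1 = m.1 →
        (r.2, m.2) ∈ ({((-32768 : ℚ), (121 : ℕ)), (-121, 121), (-24729001, 121),
          (-297756989 / 2, 289), (-882216989 / 131072, 289), (-884736, 361), (-9317, 1369),
          (-162677523113838677, 1369), (-884736000, 1849), (-147197952000, 4489),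
          (-262537412640768000, 26569), (-140625 / 8, 9), (3375 / 2, 9),
          (-1159088625 / 2097152, 9), (-189613868625 / 128, 9), (-25 / 2, 25),
          (-349938025 / 8, 25), (-121945 / 32, 25), (46969655 / 32768, 25), (-12288000, 81)} :
          Finset (ℚ × ℕ))) := by
  decide +kernel

/-- **Klein–Fricke at `2` for the ten-table schema**: no cyclic `ℚ`-isogeny of degree `2N`,
`N ∈ {11, 17, 19, 21, 27, 37, 43, 67, 163}` (the tree's `isCyclic_degree_ne_two_mul_of_jTable`,
re-derived from `stub_jTables`). [cite: Kenku1982, proof of Thm. 1, pp. 200–201] -/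
theorem lite_degree_ne_two_mul {W W' : WeierstrassCurve ℚ} [W.IsElliptic] (φ : Isogeny W W')
    (hφ : φ.IsCyclic) {N : ℕ} (hN : N ∈ ({11, 17, 19, 21, 27, 37, 43, 67, 163} : Finset ℕ)) :
    φ.degree ≠ 2 * N := fun hdeg ↦ by
  obtain ⟨t, ht, hj⟩ := φ.exists_j_eq_klein_two_of_two_dvd_degree hφ (hdeg ▸ dvd_mul_right 2 N)
  obtain ⟨V₂, hV₂, ψ, hψc, hψd, -⟩ :=
    φ.exists_isCyclic_degree_eq_of_dvd hφ (d := N) (hdeg ▸ dvd_mul_left N 2)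
  haveI := hV₂
  have hB : ∀ n ∈ ({11, 17, 19, 21, 27, 37, 43, 67, 163} : Finset ℕ),
      n ∈ ({11, 15, 17, 19, 21, 27, 37, 43, 67, 163} : Finset ℕ) ∧ n ≠ 14 := by decide
  have hmem := stub_jTables W V₂ ψ hψc (hψd ▸ (hB N hN).1)
  rw [hψd] at hmem
  exact klein_two_ne_of_check (kleinTwoCheck_table _ hmem (hB N hN).2) ht hj.symm

/-- **Klein–Fricke at `3` for the ten-table schema**: no cyclic `ℚ`-isogeny of degree `3N`,
`N ∈ {11, 17, 19, 37, 43, 67, 163}`. [cite: Kenku1982, proof of Thm. 1, pp. 200–201] -/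
theorem lite_degree_ne_three_mul {W W' : WeierstrassCurve ℚ} [W.IsElliptic] (φ : Isogeny W W')
    (hφ : φ.IsCyclic) {N : ℕ} (hN : N ∈ ({11, 17, 19, 37, 43, 67, 163} : Finset ℕ)) :
    φ.degree ≠ 3 * N := fun hdeg ↦ by
  obtain ⟨t, ht, hj⟩ :=
    φ.exists_j_eq_klein_three_of_three_dvd_degree hφ (hdeg ▸ dvd_mul_right 3 N)
  obtain ⟨V₂, hV₂, ψ, hψc, hψd, -⟩ :=
    φ.exists_isCyclic_degree_eq_of_dvd hφ (d := N) (hdeg ▸ dvd_mul_left N 3)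
  haveI := hV₂
  have hB : ∀ n ∈ ({11, 17, 19, 37, 43, 67, 163} : Finset ℕ),
      n ∈ ({11, 15, 17, 19, 21, 27, 37, 43, 67, 163} : Finset ℕ) ∧
        n ≠ 15 ∧ n ≠ 21 ∧ n ≠ 27 := by decide
  have hmem := stub_jTables W V₂ ψ hψc (hψd ▸ (hB N hN).1)
  rw [hψd] at hmem
  exact klein_three_ne_of_check
    (kleinThreeCheck_table _ hmem (hB N hN).2.1 (hB N hN).2.2.1 (hB N hN).2.2.2) ht hj.symm

/-- **Klein–Fricke at `5` for the ten-table schema**: no cyclic `ℚ`-isogeny of degree `5N`,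
`N ∈ {11, 17, 19, 37, 43, 67, 163}` (the tree's axiom-clean `isCyclic_degree_ne_five_mul_of_jTable`,
re-derived). [cite: Kenku1982, proof of Thm. 1, p. 201] -/
theorem lite_degree_ne_five_mul {W W' : WeierstrassCurve ℚ} [W.IsElliptic] (φ : Isogeny W W')
    (hφ : φ.IsCyclic) {N : ℕ} (hN : N ∈ ({11, 17, 19, 37, 43, 67, 163} : Finset ℕ)) :
    φ.degree ≠ 5 * N := fun hdeg ↦ by
  obtain ⟨t, ht, hj⟩ := φ.exists_j_eq_klein_five_of_five_dvd_degree hφ (hdeg ▸ dvd_mul_right 5 N)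
  obtain ⟨V₂, hV₂, ψ, hψc, hψd, -⟩ :=
    φ.exists_isCyclic_degree_eq_of_dvd hφ (d := N) (hdeg ▸ dvd_mul_left N 5)
  haveI := hV₂
  have hB : ∀ n ∈ ({11, 17, 19, 37, 43, 67, 163} : Finset ℕ),
      n ∈ ({11, 15, 17, 19, 21, 27, 37, 43, 67, 163} : Finset ℕ) ∧
        n ≠ 14 ∧ n ≠ 15 ∧ n ≠ 21 ∧ n ≠ 27 := by decide
  have hmem := stub_jTables W V₂ ψ hψc (hψd ▸ (hB N hN).1)
  rw [hψd] at hmem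
  exact klein_five_ne_of_check (kleinFiveCheck_table _ hmem (hB N hN).2.1 (hB N hN).2.2.1
    (hB N hN).2.2.2.1 (hB N hN).2.2.2.2) ht hj.symm

/-- The large-prime table schema `hT'` of the tree's `isCyclic_degree_ne_mul_of_jTable`, from
`stub_jTables` (an isogeny of prime degree is cyclic). [cite: Kenku1982, proof of Thm. 1, p. 200] -/
theorem largeTable_of_stub :
    ∀ (V V' : WeierstrassCurve ℚ) [V.IsElliptic] [V'.IsElliptic] (ψ : Isogeny V V'),
      ψ.degree ∈ ({11, 17, 19, 37, 43, 67, 163} : Finset ℕ) →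
        (ψ.degree, V.j) ∈ largePrimeIsogenyJTable := by
  intro V V' _ _ ψ hψ
  have hB : ∀ n ∈ ({11, 17, 19, 37, 43, 67, 163} : Finset ℕ),
      n ∈ ({11, 15, 17, 19, 21, 27, 37, 43, 67, 163} : Finset ℕ) ∧ n.Prime := by
    decide +kernel
  have hcyc : ψ.IsCyclic := by
    haveI : Fact ψ.degree.Prime := ⟨(hB _ hψ).2⟩
    exact isAddCyclic_of_prime_card (p := ψ.degree) rfl
  exact jTable_large_sub _ (stub_jTables V V' ψ hcyc (hB _ hψ).1) hψ

/-- **Every cyclic `ℚ`-isogeny avoids the radius-minimal barrier set**, from the six stubs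
(hypothesis (ii) of `stub_radius_of_mazur_of_barrier`). [cite: Kenku1982, proof of Thm. 1,
pp. 200–201] [cite: SilvermanAEC2009, IX.6 Example 6.4] -/
theorem hexcl_of_stubs :
    ∀ (V V' : WeierstrassCurve ℚ) [V.IsElliptic] [V'.IsElliptic] (φ : Isogeny V V'),
      φ.IsCyclic → φ.degree ∉ liteBarrier := by
  intro V V' _ _ φ hφ hmem
  have hbig : ∀ N ∈ ({11, 17, 19, 37, 43, 67, 163} : Finset ℕ),
      N ∈ ({11, 15, 17, 19, 21, 27, 37, 43, 67, 163} : Finset ℕ) := by decide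
  -- a `7`- or `13`-sub-isogeny together with a tabulated large-prime sub-isogeny is excluded
  have key : ∀ {q N : ℕ}, (q = 7 ∨ q = 13) → N ∈ ({11, 17, 19, 37, 43, 67, 163} : Finset ℕ) →
      φ.degree = q * N → False := by
    intro q N hq hN hd
    obtain ⟨V₂, hV₂, ψN, hψNc, hψNd, -⟩ :=
      φ.exists_isCyclic_degree_eq_of_dvd hφ (d := N) (hd ▸ dvd_mul_left N q)
    obtain ⟨V₃, hV₃, χ, -, hχd, -⟩ :=
      φ.exists_isCyclic_degree_eq_of_dvd hφ (d := q) (hd ▸ dvd_mul_right q N)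
    haveI := hV₂
    haveI := hV₃
    have hT := stub_jTables V V₂ ψN hψNc (hψNd ▸ hbig N hN)
    rw [hψNd] at hT
    have hχq : χ.degree = 7 ∨ χ.degree = 13 := by rw [hχd]; exact hq
    -- the three LANDED certificate stubs of wave 1 (`stub_certEleven/certMid/certCM`)
    rcases kenkuIsogenyJTable_large _ hT hN with hj | hj | hj
    · exact stub_certEleven V V₃ χ hχq hj
    · exact stub_certMid V V₃ χ hχq hj
    · exact stub_certCM V V₃ χ hχq hj
  -- a tabulated sub-isogeny of level `L` and a cyclic sub-isogeny of prime-power degree `m`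
  have keyPow : ∀ {L m : ℕ}, (L, m) ∈ ({(21, 9), (15, 25), (27, 81)} : Finset (ℕ × ℕ)) →
      L ∣ φ.degree → m ∣ φ.degree → False := by
    intro L m hLm hL hm
    have hL' : ∀ x ∈ ({(21, 9), (15, 25), (27, 81)} : Finset (ℕ × ℕ)),
        x.1 ∈ ({11, 15, 17, 19, 21, 27, 37, 43, 67, 163} : Finset ℕ) := by decide
    obtain ⟨V₂, hV₂, ψL, hψLc, hψLd, -⟩ := φ.exists_isCyclic_degree_eq_of_dvd hφ (d := L) hL
    obtain ⟨V₃, hV₃, χ, hχc, hχd, -⟩ := φ.exists_isCyclic_degree_eq_of_dvd hφ (d := m) hm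
    haveI := hV₂
    haveI := hV₃
    have hT := stub_jTables V V₂ ψL hψLc (by rw [hψLd]; exact hL' _ hLm)
    rw [hψLd] at hT
    refine stub_certPrimePower V V₃ χ hχc ?_
    rw [hχd]
    exact (jTable_primePower_mem _ hT).2 _ hLm rfl
  rcases liteBarrier_split _ hmem with hD | ⟨N, hN, hd⟩ | ⟨N, hN, hd⟩ | ⟨N, hN, hd⟩ |
      ⟨N, hN, hd⟩ | ⟨N, hN, hd⟩ | ⟨q, hq, hne, hd⟩ | ⟨N, hN, hd⟩ | hrest
  · exact liteLevels_of_stubs V V' φ hφ hD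
  · exact lite_degree_ne_two_mul φ hφ hN hd
  · exact lite_degree_ne_three_mul φ hφ hN hd
  · exact lite_degree_ne_five_mul φ hφ hN hd
  · exact key (Or.inl rfl) hN hd
  · exact key (Or.inr rfl) hN hd
  · rw [Finset.mem_product] at hq
    exact isCyclic_degree_ne_mul_of_jTable largeTable_of_stub φ hφ hq.1 hq.2 hne hd
  · -- `p²`: the cyclic `p`-sub-isogeny puts `j` in the table; `φ` itself is the certified one
    obtain ⟨V₂, hV₂, ψN, hψNc, hψNd, -⟩ :=
      φ.exists_isCyclic_degree_eq_of_dvd hφ (d := N) (hd ▸ dvd_mul_left N N)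
    haveI := hV₂
    have hT := stub_jTables V V₂ ψN hψNc (hψNd ▸ hbig N hN)
    rw [hψNd] at hT
    refine stub_certPrimePower V V' φ hφ ?_
    rw [hd]
    exact (jTable_primePower_mem _ hT).1 hN
  · rcases hrest with h | h | h | h | h
    · exact keyPow (L := 21) (m := 9) (by decide) (h ▸ (by norm_num : (21 : ℕ) ∣ 63))
        (h ▸ (by norm_num : (9 : ℕ) ∣ 63))
    · exact keyPow (L := 15) (m := 25) (by decide) (h ▸ (by norm_num : (15 : ℕ) ∣ 75))
        (h ▸ (by norm_num : (25 : ℕ) ∣ 75))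
    · exact keyPow (L := 27) (m := 81) (by decide) (h ▸ (by norm_num : (27 : ℕ) ∣ 81))
        (h ▸ dvd_rfl)
    · -- `273 = 21 · 13`
      obtain ⟨V₂, hV₂, ψL, hψLc, hψLd, -⟩ :=
        φ.exists_isCyclic_degree_eq_of_dvd hφ (d := 21) (h ▸ (by norm_num : (21 : ℕ) ∣ 273))
      obtain ⟨V₃, hV₃, χ, -, hχd, -⟩ :=
        φ.exists_isCyclic_degree_eq_of_dvd hφ (d := 13) (h ▸ (by norm_num : (13 : ℕ) ∣ 273))
      haveI := hV₂
      haveI := hV₃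
      have hT := stub_jTables V V₂ ψL hψLc (by rw [hψLd]; decide)
      rw [hψLd] at hT
      exact stub_certThirteenComposite V V₃ χ hχd (jTable_21_27_mem _ hT (Or.inl rfl))
    · -- `351 = 27 · 13`
      obtain ⟨V₂, hV₂, ψL, hψLc, hψLd, -⟩ :=
        φ.exists_isCyclic_degree_eq_of_dvd hφ (d := 27) (h ▸ (by norm_num : (27 : ℕ) ∣ 351))
      obtain ⟨V₃, hV₃, χ, -, hχd, -⟩ :=
        φ.exists_isCyclic_degree_eq_of_dvd hφ (d := 13) (h ▸ (by norm_num : (13 : ℕ) ∣ 351))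
      haveI := hV₂
      haveI := hV₃
      have hT := stub_jTables V V₂ ψL hψLc (by rw [hψLd]; decide)
      rw [hψLd] at hT
      exact stub_certThirteenComposite V V₃ χ hχd (jTable_21_27_mem _ hT (Or.inr rfl))

/-- **The Mazur–Kenku radius from the stubs of the merged line `radius-lite`+`Sketch`**: two `ℚ`-isogenous elliptic
curves over `ℚ` are joined by a `ℚ`-isogeny of degree `≤ 163` — the landed set-cover reduction
`stub_radius_of_mazur_of_barrier` fed with `liteBarrier_covers`, `hexcl_of_stubs` and Mazur's
Thm. 1 (`mazur_isogeny_irreducible_holds_of stub_cor44` + the PROVED Prop. 5.1). This is the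
sibling item stmt-ABC-15193 (`MazurKenkuRadius`) modulo the stubs. [cite: Mazur1978, Thm. 1]
[cite: Kenku1982, Thm. 1] [cite: SilvermanAEC2009, IX.6 Example 6.4] -/
theorem mazurKenkuRadius_of_liteStubs :
    Summit.ABC.ABC.Theses.RibetTakahashiSplit.MazurKenkuRadius :=
  fun W W' _ _ hW ↦ stub_radius_of_mazur_of_barrier liteBarrier liteBarrier_covers hexcl_of_stubs
    (mazur_isogeny_irreducible_holds_of stub_cor44
      Mazur1978.prop51_exponent_classes_of_additive_holds) W W' hW

/-- **The crux `MazurKenkuBound` (stmt-ABC-15125) from the stubs of the merged line**: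
the landed `mazurKenkuBound_of_radiusItem` (p135527) applied to `mazurKenkuRadius_of_liteStubs`.
[cite: PastenShimura2024, §3 p. 13] [cite: Mazur1978, Thm. 1] [cite: Kenku1982, Thm. 1]
[cite: EdixhovenManin1991, Prop. 2] -/
theorem MazurKenkuBound_of : Summit.ABC.ABC.Theses.IsogenyGlueCongruence.MazurKenkuBound :=
  mazurKenkuBound_of_radiusItem mazurKenkuRadius_of_liteStubs

end Summit.ABC.ABC.Theorems

end
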